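import Literature.Algebra.Homology.DiscreteRepCoinduced
import Literature.Algebra.Homology.ExtAdjunction
import Mathlib.Algebra.Category.ModuleCat.Ext.HasExt
import Mathlib.Algebra.Homology.ShortComplex.ExactFunctor
import HarnessLib

/-!
# Shapiro's lemma for the trivial subgroup: `Extⁿ_{C_Γ}(A, CoInd V) ≅ Extⁿ_k(A, V)`

Topic `Algebra/Homology`; namespace `Literature.Algebra.Homology.DiscreteRep`.  Sequel of
`DiscreteRepCoinduced` (`coindFunctor : Mod_k ⥤ C_Γ`, right adjoint to the forgetful functor, exact,
for `Γ` compact) and `ExtAdjunction` (Eckmann–Shapiro for Mathlib's `Abelian.Ext` along an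
adjunction with exact adjoints); no named fact, no `sorry`.

* `coindFunctor` is additive and EXACT as a functor between abelian categories
  (`PreservesFiniteColimits`, from `shortExact_map_coindFunctor` through Mathlib's
  `Functor.preservesFiniteColimits_iff_forall_exact_map_and_epi`).
* **`extCoindAddEquiv A V n : Ext_{Mod_k} (A.obj.V) V n ≃+ Ext_{C_Γ} A (coind k Γ V) n`** — Shapiro's
  lemma for the trivial subgroup (Serre, *Cohomologie galoisienne* I §2.5 Prop. 10; Harari
  Remark 16.13 with `H = 1`; Weibel Lemma 6.3.2), for every discrete `A` and every `k`-module `V`.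
* Corollary `ext_triv_coind_eq_zero'`: `Ext^{q+1}_{C_Γ}(triv k, CoInd V) = 0` again, now because
  `Ext^{q+1}_k(k, V) = 0` (`k` is a projective `k`-module) — a second proof of
  `DiscreteRepCoinduced.ext_triv_coind_eq_zero`.

## References
* J.-P. Serre, *Galois Cohomology*, Springer (1997), I §2.5. [SerreGaloisCohomology1997]
* C. A. Weibel, *An introduction to homological algebra* (1994), Lemma 6.3.2. [Weibel1994]
-/

-- CITATION-FIX (2026-08-27, door-c4 g13; referee flags Q-g50-1/Q-g51-1, held copy
-- `book:harari2017-galois-cohomology-class-field-theory`): earlier revisions of this file cited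
-- "Harari Prop. 16.17" for Shapiro-type isomorphisms of `Ext`.  Prop. 16.17 (p. 272) is the
-- compatibility of the cup-product with the `Ext` pairing; the printed homes are Remark 16.13
-- (p. 269: `Ext_G^i(A, I_G^H(B)) ≃ Ext_H^i(A, B)`), Proposition 1.39 (p. 48: first variable,
-- `Ext_H^i(A, B) ≃ Ext_G^i(I_G^H(A), B)`, valid for `H` open by §4.3 (4), p. 97) and, for the
-- adjunctions, Propositions 1.12 / 1.15 (§1.2).  Citations below corrected; declarations unchanged.

noncomputable section

universe u

namespace Literature.Algebra.Homology

namespace DiscreteRep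

open CategoryTheory CategoryTheory.Limits CategoryTheory.Abelian

variable {k Γ : Type u} [CommRing k] [Group Γ] [TopologicalSpace Γ] [IsTopologicalGroup Γ]
  [CompactSpace Γ]

/-- `CoInd : Mod_k ⥤ C_Γ` is additive (right adjoint of an additive functor).
[cite: SerreGaloisCohomology1997, I §2.5] -/
instance : (coindFunctor k Γ).Additive := (forgetCoindAdjunction k Γ).right_adjoint_additive

/-- **`CoInd` is right exact** (it carries short exact sequences to short exact sequences,
`shortExact_map_coindFunctor`). [cite: SerreGaloisCohomology1997, I §2.5] -/
instance : PreservesFiniteColimits (coindFunctor k Γ) :=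
  ((coindFunctor k Γ).preservesFiniteColimits_iff_forall_exact_map_and_epi).2 fun _ hS =>
    ⟨(shortExact_map_coindFunctor hS).exact, (shortExact_map_coindFunctor hS).epi_g⟩

/-- `CoInd` is left exact (a right adjoint). [cite: SerreGaloisCohomology1997, I §2.5] -/
instance : PreservesFiniteLimits (coindFunctor k Γ) := inferInstance

omit [IsTopologicalGroup Γ] [CompactSpace Γ] in
/-- The forgetful functor `C_Γ ⥤ Mod_k` on objects. [cite: SerreGaloisCohomology1997, I §2.5] -/
theorem forget_obj (A : DiscreteRepCat k Γ) :
    (ι k Γ ⋙ forget₂ (Rep.{u} k Γ) (ModuleCat.{u} k)).obj A = ModuleCat.of k A.obj.V := rfl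

/-- **Shapiro's lemma for the trivial subgroup: `Extⁿ_k(A, V) ≃+ Extⁿ_{C_Γ}(A, CoInd V)`** for every
discrete representation `A` of the compact group `Γ` and every `k`-module `V` (Eckmann–Shapiro along
`forget ⊣ CoInd`; the source is `Ext` in `Mod_k` of the underlying module `forget_obj`).
[cite: SerreGaloisCohomology1997, I §2.5][cite: Weibel1994, Lemma 6.3.2] -/
def extCoindAddEquiv (A : DiscreteRepCat k Γ) (V : ModuleCat.{u} k) (n : ℕ) :
    Ext ((ι k Γ ⋙ forget₂ (Rep.{u} k Γ) (ModuleCat.{u} k)).obj A) V n ≃+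
      Ext A ((coindFunctor k Γ).obj V) n :=
  ExtAdjunction.extAddEquiv (forgetCoindAdjunction k Γ) A V n

/-- In degree `0` it is Frobenius reciprocity on `mk₀`. [cite: SerreGaloisCohomology1997, I §2.5] -/
theorem extCoindAddEquiv_zero_mk₀ (A : DiscreteRepCat k Γ) (V : ModuleCat.{u} k)
    (f : (ι k Γ ⋙ forget₂ (Rep.{u} k Γ) (ModuleCat.{u} k)).obj A ⟶ V) :
    extCoindAddEquiv A V 0 (Ext.mk₀ f) =
      Ext.mk₀ ((forgetCoindAdjunction k Γ).homEquiv A V f) :=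
  ExtAdjunction.extAddEquiv_zero_mk₀ _ A V f

/-- `k` (the underlying module of `triv k`) is projective in `Mod_k`. [cite: Weibel1994, Lemma 6.3.2] -/
instance : Projective ((ι k Γ ⋙ forget₂ (Rep.{u} k Γ) (ModuleCat.{u} k)).obj (triv (Γ := Γ) k)) :=
  inferInstanceAs (Projective (ModuleCat.of k k))

/-- Second proof of the acyclicity of co-induced modules: `Ext^{q+1}_{C_Γ}(triv k, CoInd V) = 0`
because `Ext^{q+1}_k(k, V) = 0` (`k` is projective). [cite: SerreGaloisCohomology1997, I §2.5] -/
theorem ext_triv_coind_eq_zero' (q : ℕ) (V : ModuleCat.{u} k)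
    (e : Ext (triv (Γ := Γ) k) ((coindFunctor k Γ).obj V) (q + 1)) : e = 0 := by
  obtain ⟨x, rfl⟩ := (extCoindAddEquiv (triv (Γ := Γ) k) V (q + 1)).surjective e
  have hx : x = 0 := Ext.eq_zero_of_projective x
  rw [hx, map_zero]

end DiscreteRep

end Literature.Algebra.Homology
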